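import Literature.Probability.RandomPlanarGeometry.SLERestrictionLocalMartingale
import Literature.Probability.Process.NestedStoppedMartingales
import Literature.Probability.Process.MartingaleLimit
import HarnessLib

/-!
# The restriction martingale along the localising times: nesting, and the terminal limit

We prepare the passage from the localised martingales `Mⁿ = Ỹ^{Tₙ}` of
`SLERestrictionLocalMartingale` to the restriction martingale of [LSW] Prop. 5.2/5.3 / proof of
Thm. 6.1 ("by the martingale convergence theorem, the a.s. limit `Y_T := lim_{t ↗ T} Y_t`
exists"):

* `Yproc` — the process `(Φ'_{A_t - W_t}(0) 𝟙{alive})^{5/8}`, bounded by `1`;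
* `monotone_locTime` — `T₀ ≤ T₁ ≤ ⋯`; `exists_forall_locTime_pos` — `Tₖ > 0` for `k ≥ k₀`
  (a deterministic `k₀`); `stoppedProcess_Yproc_eq_locMart` — `Y^{Tₖ} = Mᵏ` for such `k`, so that
  every `Y^{Tₖ}` is a martingale with continuous paths;
* `disjoint_closedHull_iff_exists_lt_locTime` — the alive times are exactly `⋃ₖ [0, Tₖ)`;
* `ae_cauchy_stoppedProcess_Yproc` — the nested stopped processes are a.s. uniformly Cauchy at the
  terminal time (`Process.ae_nested_stoppedProcess_cauchy`), the form in which the limit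
  `lim_{t ↗ T} Y_t` and the limit at `∞` are extracted downstream.

## References

* G. F. Lawler, O. Schramm, W. Werner, *Conformal restriction: the chordal case* (2003), §5 and
  proof of Thm. 6.1 [LawlerSchrammWerner2003Restriction].
* D. Revuz, M. Yor, *Continuous Martingales and Brownian Motion* (1999), Ch. II Thm (2.10).
-/

noncomputable section

open Set Filter Metric Function MeasureTheory ProbabilityTheory
open _root_.Complex _root_.Topology
open Literature.Probability.Process (brownian preWienerMeasure)
open scoped NNReal

namespace Literature.Probability.RandomPlanarGeometry

open Loewner PathOps

section Nesting

variable {A : Set ℂ} {hA : IsStarHull A} {hne : A.Nonempty}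

/-- **The process `Y_t = (Φ'_{A_t - W_t}(0) 𝟙{alive})^{5/8}`.** [cite: LawlerSchrammWerner2003Restriction, §5 (Y_t)] -/
def Yproc (A : Set ℂ) (t : ℝ≥0) (ω : ℝ≥0 → ℝ) : ℝ := DFn A t (brownianCPath ω) ^ (5 / 8 : ℝ)

/-- `0 ≤ Y ≤ 1`. [folklore] -/
theorem Yproc_mem_Icc (t : ℝ≥0) (ω : ℝ≥0 → ℝ) : Yproc A t ω ∈ Icc (0 : ℝ) 1 := by
  obtain ⟨-, -, h0, h1⟩ := DFn_eq (A := A) t (brownianCPath ω)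
  exact ⟨Real.rpow_nonneg h0 _, Real.rpow_le_one h0 h1 (by norm_num)⟩

/-- `|Y| ≤ 1`. [folklore] -/
theorem abs_Yproc_le (t : ℝ≥0) (ω : ℝ≥0 → ℝ) : |Yproc A t ω| ≤ 1 := by
  rw [abs_of_nonneg (Yproc_mem_Icc (A := A) t ω).1]; exact (Yproc_mem_Icc t ω).2

/-! ### Monotonicity of the localising times -/

/-- Comparison of hitting times of closed sets by continuous paths: if hitting `s'` by `u'` forces
having hit `s` by `u`, then `hit(u, s) ≤ hit(u', s')`. [folklore] -/
theorem hittingAfter_le_hittingAfter {u u' : ℝ≥0 → (ℝ≥0 → ℝ) → ℝ} {s s' : Set ℝ} {ω : ℝ≥0 → ℝ}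
    (hs : IsClosed s) (hs' : IsClosed s') (hc : Continuous fun t ↦ u t ω) (hc' : Continuous fun t ↦ u' t ω)
    (h : ∀ t, u' t ω ∈ s' → u t ω ∈ s) : hittingAfter u s 0 ω ≤ hittingAfter u' s' 0 ω := by
  rcases eq_or_ne (hittingAfter u' s' 0 ω) ⊤ with htop | hne'
  · rw [htop]; exact le_top
  · obtain ⟨i, hi⟩ := WithTop.ne_top_iff_exists.1 hne'
    rw [← hi]
    have h1 : hittingAfter u' s' 0 ω ≤ (i : WithTop ℝ≥0) := by rw [hi]
    obtain ⟨j, hj, hjs⟩ := (Process.hittingAfter_zero_le_coe_iff hs' hc').1 h1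
    exact (Process.hittingAfter_zero_le_coe_iff hs hc).2 ⟨j, hj, h j hjs⟩

/-- `D̂ⁿ ≤ D̂ᵐ` for `n ≤ m`. [folklore] -/
theorem Dhatp_mono {n m : ℕ} (hnm : n ≤ m) (t : ℝ≥0) (ω : ℝ≥0 → ℝ) : Dhatp hA hne n t ω ≤ Dhatp hA hne m t ω := by
  simp only [Dhatp, DhatFn]
  refine min_le_min le_rfl (mul_le_mul_of_nonneg_right (by exact_mod_cast hnm) (RFn_nonneg _ _))

/-- The levels decrease. [folklore] -/
theorem locLevel_anti {n m : ℕ} (hnm : n ≤ m) : locLevel m ≤ locLevel n := by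
  rw [locLevel, locLevel]
  have : (n : ℝ) ≤ m := by exact_mod_cast hnm
  exact one_div_le_one_div_of_le (by positivity) (by linarith)

/-- **`T₀ ≤ T₁ ≤ ⋯`** (smaller levels and larger `D̂` are hit later). [folklore] -/
theorem monotone_locTime (ω : ℝ≥0 → ℝ) : Monotone fun k ↦ locTime hA hne k ω := by
  refine monotone_nat_of_le_succ fun k ↦ ?_
  obtain ⟨hRc, -⟩ := continuous_Rp_Dhatp (hA := hA) (hne := hne) 0 ω
  have hDc := fun j ↦ (continuous_Rp_Dhatp (hA := hA) (hne := hne) j ω).2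
  have hlev := locLevel_anti (Nat.le_succ k)
  refine min_le_min (min_le_min ?_ ?_) (by push_cast; exact_mod_cast (le_self_add : (k : ℝ≥0) + 1 ≤ (k : ℝ≥0) + 1 + 1))
  · exact hittingAfter_le_hittingAfter isClosed_Iic isClosed_Iic hRc hRc fun t ht ↦ (mem_Iic.1 ht).trans hlev
  · exact hittingAfter_le_hittingAfter isClosed_Iic isClosed_Iic (hDc _) (hDc _) fun t ht ↦
      ((Dhatp_mono (Nat.le_succ (k + 1)) t ω).trans (mem_Iic.1 ht)).trans hlev

/-! ### The values at time `0`, and positivity of `Tₖ` for large `k` -/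

/-- At time `0` the slid hull is `A`. [folklore] -/
theorem slidHull_drv_zero (hA : IsStarHull A) (υ : C(ℝ≥0, ℝ)) : slidHull (drv υ) A 0 = A := by
  rw [slidHull_zero (continuous_drv υ) (by rw [drv_zero, Complex.ofReal_zero]; exact hA.zero_notMem), drv_zero]
  simp

/-- **The values at time `0` are deterministic**: `R_0 = min dist(0, A) 1`,
`D̂ⁿ_0 = min Φ'_A(0) (n R_0)`. [folklore] -/
theorem Rp_Dhatp_zero (hA : IsStarHull A) (hne : A.Nonempty) (n : ℕ) (ω : ℝ≥0 → ℝ) :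
    Rp hA hne 0 ω = min (infDist 0 A) 1 ∧ Dhatp hA hne n 0 ω = min (starDeriv A) (n * min (infDist 0 A) 1) := by
  have halive := disjoint_closedHull_zero (A := A) hA (brownianCPath ω)
  have hR : Rp hA hne 0 ω = min (infDist 0 A) 1 := by
    obtain ⟨s₀, hs₀, -, heq⟩ := exists_aliveFn_eq_min (W := fun υ : C(ℝ≥0, ℝ) ↦ drv υ) (continuous_drv _) hA hne
      (denseSeq_spec hA hne).1 (denseSeq_spec hA hne).2 halive
    have : s₀ = 0 := le_antisymm hs₀ bot_le
    rw [this, slidHull_drv_zero hA] at heq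
    exact heq
  refine ⟨hR, ?_⟩
  rw [Dhatp, DhatFn, (DFn_eq (A := A) 0 (brownianCPath ω)).1 halive, slidHull_drv_zero hA]
  congr 1
  change (n : ℝ) * Rp hA hne 0 ω = _
  rw [hR]

/-- **`Tₖ > 0` for all paths once `k` is large** (the time-`0` values are deterministic and positive).
[folklore] -/
theorem exists_forall_locTime_pos (hA : IsStarHull A) (hne : A.Nonempty) : ∃ k₀ : ℕ, ∀ k, k₀ ≤ k → ∀ ω, (0 : WithTop ℝ≥0) < locTime hA hne k ω := by
  obtain ⟨hm0, -⟩ := infDist_zero_pos hA hne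
  obtain ⟨hd0, -, -⟩ := starDeriv_spec hA
  set r₀ : ℝ := min (infDist 0 A) 1 with hr₀
  have hr₀0 : 0 < r₀ := lt_min hm0 one_pos
  set θ : ℝ := min r₀ (starDeriv A) with hθ
  have hθ0 : 0 < θ := lt_min hr₀0 hd0
  obtain ⟨k₀, hk₀⟩ := exists_nat_gt (1 / θ + 1 / r₀)
  refine ⟨k₀, fun k hk ω ↦ ?_⟩
  have hk' : (1 / θ + 1 / r₀ : ℝ) < k := hk₀.trans_le (by exact_mod_cast hk)
  have hck : locLevel k < θ := by
    rw [locLevel, div_lt_iff₀ (by positivity)]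
    have h1 : 1 / θ < k := by have := one_div_pos.2 hr₀0; linarith
    rw [div_lt_iff₀ hθ0] at h1; nlinarith
  have hck' : locLevel k < (k + 1 : ℕ) * r₀ := by
    rw [locLevel]
    have h1 : 1 / r₀ < k := by have := one_div_pos.2 hθ0; linarith
    rw [div_lt_iff₀ hr₀0] at h1
    have hc1 : 1 / ((k : ℝ) + 1) ≤ 1 := by rw [div_le_one (by positivity)]; linarith
    push_cast; nlinarith
  obtain ⟨hR0, hD0⟩ := Rp_Dhatp_zero hA hne (k + 1) ω
  obtain ⟨hRc, -⟩ := continuous_Rp_Dhatp (hA := hA) (hne := hne) 0 ω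
  have hDc := (continuous_Rp_Dhatp (hA := hA) (hne := hne) (k + 1) ω).2
  -- none of the three clocks rings at time `0`
  rw [locTime]
  refine lt_min (lt_min ?_ ?_) (by exact_mod_cast (show (0 : ℝ≥0) < (k : ℝ≥0) + 1 by positivity))
  · by_contra hle
    rw [not_lt, ← WithTop.coe_zero, Process.hittingAfter_zero_le_coe_iff isClosed_Iic hRc] at hle
    obtain ⟨j, hj, hjs⟩ := hle
    have : j = 0 := le_antisymm hj bot_le
    rw [this, mem_Iic, hR0] at hjs
    have := min_le_left r₀ (starDeriv A)
    linarith
  · by_contra hle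
    rw [not_lt, ← WithTop.coe_zero, Process.hittingAfter_zero_le_coe_iff isClosed_Iic hDc] at hle
    obtain ⟨j, hj, hjs⟩ := hle
    have : j = 0 := le_antisymm hj bot_le
    rw [this, mem_Iic, hD0] at hjs
    rcases min_cases (starDeriv A) (((k + 1 : ℕ) : ℝ) * min (infDist 0 A) 1) with ⟨h1, -⟩ | ⟨h1, -⟩
    · rw [h1] at hjs; have := min_le_right r₀ (starDeriv A); linarith
    · rw [h1] at hjs; linarith

/-! ### `Y^{Tₖ} = Mᵏ` -/

/-- **The stopped process `Y^{Tₖ}` is the localised martingale `Mᵏ`** whenever `Tₖ > 0` everywhere.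
[folklore] -/
theorem stoppedProcess_Yproc_eq_locMart {k : ℕ} (hk : ∀ ω, (0 : WithTop ℝ≥0) < locTime hA hne k ω) :
    stoppedProcess (Yproc A) (locTime hA hne k) = locMart hA hne k := by
  funext t ω
  rw [locMart, stoppedProcess, stoppedProcess, Yproc, Ytil]
  set r := (min (t : WithTop ℝ≥0) (locTime hA hne k ω)).untopA with hr
  have hrT : (r : WithTop ℝ≥0) ≤ locTime hA hne k ω := by
    rw [hr, Process.coe_untopA_min]; exact min_le_right _ _
  obtain ⟨halive, -, hDeq, -, -⟩ := controlled_of_le_locTime hrT (hk ω)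
  rw [hDeq, (DFn_eq (A := A) r (brownianCPath ω)).1 halive]

/-- Every `Y^{Tₖ}` (large `k`) is a martingale with continuous paths. [folklore] -/
theorem martingale_stoppedProcess_Yproc {k : ℕ} (hk : ∀ ω, (0 : WithTop ℝ≥0) < locTime hA hne k ω) :
    Martingale (stoppedProcess (Yproc A) (locTime hA hne k)) brownianFiltration preWienerMeasure ∧
      ∀ ω, Continuous fun t ↦ stoppedProcess (Yproc A) (locTime hA hne k) t ω := by
  rw [stoppedProcess_Yproc_eq_locMart hk]
  exact ⟨martingale_locMart, fun ω ↦ Process.continuous_stoppedProcess_path (continuous_Ytil ω) _⟩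


/-! ### The alive times are `⋃ₖ [0, Tₖ)` -/

/-- **Alive at `t` iff `t < Tₖ` for some `k`.** [folklore] -/
theorem disjoint_closedHull_iff_exists_lt_locTime (t : ℝ≥0) (ω : ℝ≥0 → ℝ) :
    Disjoint (closedHull (drv (brownianCPath ω)) t) A ↔ ∃ k, (t : WithTop ℝ≥0) < locTime hA hne k ω := by
  constructor
  swap
  · rintro ⟨k, hk⟩
    exact (controlled_of_lt_locTime hk).1
  intro halive
  by_contra hnot
  push Not at hnot
  set W := drv (brownianCPath ω) with hW
  have hWc : Continuous W := continuous_drv _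
  have hall : ∀ s ∈ Icc (0 : ℝ≥0) t, Disjoint (closedHull W s) A := fun s hs ↦ alive_mono hs.2 halive
  -- positive minima of `R` and `Φ'` on `[0, t]`
  obtain ⟨hRc, -⟩ := continuous_Rp_Dhatp (hA := hA) (hne := hne) 0 ω
  obtain ⟨sR, hsR, hminR⟩ := isCompact_Icc.exists_isMinOn ⟨0, left_mem_Icc.2 bot_le⟩ (hRc.continuousOn (s := Icc (0 : ℝ≥0) t))
  have hμR : 0 < Rp hA hne sR ω := (RFn_pos_iff sR (brownianCPath ω)).2 (hall sR hsR)
  have hdcont : ContinuousOn (fun s : ℝ≥0 ↦ starDeriv (slidHull W A s)) (Icc 0 t) := fun s hs ↦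
    (continuousWithinAt_starDeriv_slidHull hWc hA hne (hall s hs)).mono fun s' hs' ↦ hall s' hs'
  obtain ⟨sd, hsd, hmind⟩ := isCompact_Icc.exists_isMinOn ⟨0, left_mem_Icc.2 bot_le⟩ hdcont
  have hμd : 0 < starDeriv (slidHull W A sd) := (starDeriv_pos_le_one _).1
  -- a large `k`
  set θ := min (Rp hA hne sR ω) (starDeriv (slidHull W A sd)) with hθ
  have hθ0 : 0 < θ := lt_min hμR hμd
  obtain ⟨k, hk⟩ := exists_nat_gt (1 / θ + (t : ℝ))
  have hck : locLevel k < θ := by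
    rw [locLevel, div_lt_iff₀ (by positivity)]
    have h1 : 1 / θ < k := by have := t.coe_nonneg; linarith
    rw [div_lt_iff₀ hθ0] at h1; nlinarith
  have hkt : (t : ℝ) < k + 1 := by have := one_div_pos.2 hθ0; linarith
  have hle := hnot k
  rw [locTime] at hle
  have hDc := (continuous_Rp_Dhatp (hA := hA) (hne := hne) (k + 1) ω).2
  rcases min_le_iff.1 hle with h12 | h3
  · rcases min_le_iff.1 h12 with h1 | h2
    · obtain ⟨j, hj, hjs⟩ := (Process.hittingAfter_zero_le_coe_iff isClosed_Iic hRc).1 h1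
      have e2 : Rp hA hne sR ω ≤ Rp hA hne j ω := hminR (show j ∈ Icc (0 : ℝ≥0) t from ⟨bot_le, hj⟩)
      rw [mem_Iic] at hjs
      have := min_le_left (Rp hA hne sR ω) (starDeriv (slidHull W A sd))
      linarith
    · obtain ⟨j, hj, hjs⟩ := (Process.hittingAfter_zero_le_coe_iff isClosed_Iic hDc).1 h2
      rw [mem_Iic] at hjs
      have hjalive := hall j ⟨bot_le, hj⟩
      have hD : Dhatp hA hne (k + 1) j ω = min (starDeriv (slidHull W A j)) ((k + 1 : ℕ) * Rp hA hne j ω) := by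
        rw [Dhatp, DhatFn, (DFn_eq (A := A) j (brownianCPath ω)).1 hjalive]; rfl
      rw [hD] at hjs
      have e1 : starDeriv (slidHull W A sd) ≤ starDeriv (slidHull W A j) := hmind (show j ∈ Icc (0 : ℝ≥0) t from ⟨bot_le, hj⟩)
      have e2 : Rp hA hne sR ω ≤ Rp hA hne j ω := hminR (show j ∈ Icc (0 : ℝ≥0) t from ⟨bot_le, hj⟩)
      have hR0 : 0 ≤ Rp hA hne j ω := RFn_nonneg (hA := hA) (hne := hne) j (brownianCPath ω)
      have hk1 : (1 : ℝ) ≤ (k + 1 : ℕ) := by exact_mod_cast Nat.succ_pos k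
      have e3 : Rp hA hne j ω ≤ ((k + 1 : ℕ) : ℝ) * Rp hA hne j ω := by nlinarith
      have hm1 := min_le_left (Rp hA hne sR ω) (starDeriv (slidHull W A sd))
      have hm2 := min_le_right (Rp hA hne sR ω) (starDeriv (slidHull W A sd))
      rcases min_cases (starDeriv (slidHull W A j)) (((k + 1 : ℕ) : ℝ) * Rp hA hne j ω) with ⟨h, -⟩ | ⟨h, -⟩
      · rw [h] at hjs; linarith
      · rw [h] at hjs; linarith
  · have : (t : ℝ) ≥ k + 1 := by
      have h' : ((k : ℝ≥0) + 1 : ℝ≥0) ≤ t := by exact_mod_cast h3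
      exact_mod_cast h'
    linarith

/-! ### The a.s. Cauchy property at the terminal time -/

/-- **The nested stopped processes `Y^{T_{k+k₀}}` are a.s. uniformly Cauchy** (martingale convergence
in the form of `Process.ae_nested_stoppedProcess_cauchy`). [cite: LawlerSchrammWerner2003Restriction, proof of Thm. 6.1] -/
theorem ae_cauchy_stoppedProcess_Yproc {k₀ : ℕ} (hk₀ : ∀ k, k₀ ≤ k → ∀ ω, (0 : WithTop ℝ≥0) < locTime hA hne k ω) :
    ∀ᵐ ω ∂preWienerMeasure, ∀ ε : ℝ, 0 < ε → ∃ K : ℕ, ∀ k, K ≤ k → ∀ J, k ≤ J → ∀ r : ℝ≥0,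
      |stoppedProcess (Yproc A) (locTime hA hne (J + k₀)) r ω - stoppedProcess (Yproc A) (locTime hA hne (k + k₀)) r ω| ≤ ε := by
  haveI := isProbabilityMeasure_preWienerMeasure'
  have hpos : ∀ k ω, (0 : WithTop ℝ≥0) < locTime hA hne (k + k₀) ω := fun k ω ↦ hk₀ _ le_add_self ω
  exact Process.ae_nested_stoppedProcess_cauchy (τ := fun k ω ↦ locTime hA hne (k + k₀) ω)
    (fun ω k J hkJ ↦ monotone_locTime ω (by omega)) (fun k ↦ (isStoppingTime_locTime (k + k₀)).isOptionalTime)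
    (fun k ↦ (martingale_stoppedProcess_Yproc (hpos k)).1) (fun t ω ↦ abs_Yproc_le t ω)
    (fun k ↦ ae_of_all _ (martingale_stoppedProcess_Yproc (hpos k)).2)

/-! ### The limit process -/

/-- `limsup` over `ℕ` of measurable real functions is measurable, for any σ-algebra. [folklore] -/
theorem measurable_limsup_real {Ω : Type*} {m : MeasurableSpace Ω} {f : ℕ → Ω → ℝ} (hf : ∀ k, Measurable[m] (f k)) :
    Measurable[m] fun ω ↦ limsup (fun k ↦ f k ω) atTop :=
  Measurable.limsup hf

variable (hA hne) in
/-- **The restriction martingale** `Ȳ_t = limsup_k M^{k+k₀}_t` (the a.s. limit of the localised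
martingales; `= Y_t` before the hitting time, frozen afterwards). [cite: LawlerSchrammWerner2003Restriction, proof of Thm. 6.1] -/
def Ybar (k₀ : ℕ) (t : ℝ≥0) (ω : ℝ≥0 → ℝ) : ℝ := limsup (fun k ↦ locMart hA hne (k + k₀) t ω) atTop

/-- `Ȳ` is strongly adapted. [folklore] -/
theorem stronglyAdapted_Ybar (k₀ : ℕ) : StronglyAdapted brownianFiltration (Ybar hA hne k₀) := fun t ↦
  (measurable_limsup_real fun k ↦ (stronglyAdapted_locMart (hA := hA) (hne := hne) (n := k + k₀) t).measurable).stronglyMeasurable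

/-- A Cauchy sequence of reals converges to its `limsup`. [folklore] -/
theorem tendsto_limsup_of_cauchy {x : ℕ → ℝ}
    (hc : ∀ ε : ℝ, 0 < ε → ∃ K, ∀ k, K ≤ k → ∀ J, k ≤ J → |x J - x k| ≤ ε) :
    Tendsto x atTop (𝓝 (limsup x atTop)) := by
  have hcs : CauchySeq x := by
    rw [Metric.cauchySeq_iff']
    intro ε hε
    obtain ⟨K, hK⟩ := hc (ε / 2) (by positivity)
    refine ⟨K, fun J hJ ↦ ?_⟩
    rw [Real.dist_eq]
    exact lt_of_le_of_lt (hK K le_rfl J hJ) (by linarith)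
  obtain ⟨c, hc'⟩ := cauchySeq_tendsto_of_complete hcs
  rwa [hc'.limsup_eq]

/-- **A.s., the localised martingales converge to `Ȳ` at every time.** [folklore] -/
theorem ae_tendsto_locMart_Ybar {k₀ : ℕ} (hk₀ : ∀ k, k₀ ≤ k → ∀ ω, (0 : WithTop ℝ≥0) < locTime hA hne k ω) :
    ∀ᵐ ω ∂preWienerMeasure, ∀ t, Tendsto (fun k ↦ locMart hA hne (k + k₀) t ω) atTop (𝓝 (Ybar hA hne k₀ t ω)) := by
  filter_upwards [ae_cauchy_stoppedProcess_Yproc hk₀] with ω hω t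
  have hpos : ∀ k ω, (0 : WithTop ℝ≥0) < locTime hA hne (k + k₀) ω := fun k ω ↦ hk₀ _ le_add_self ω
  have heq : ∀ k, locMart hA hne (k + k₀) t ω = stoppedProcess (Yproc A) (locTime hA hne (k + k₀)) t ω := fun k ↦ by
    rw [stoppedProcess_Yproc_eq_locMart (hpos k)]
  rw [Ybar]
  simp_rw [heq]
  refine tendsto_limsup_of_cauchy fun ε hε ↦ ?_
  obtain ⟨K, hK⟩ := hω ε hε
  exact ⟨K, fun k hk J hJ ↦ hK k hk J hJ t⟩

/-- **`Ȳ` is a martingale** (bounded a.s. limit of martingales). [cite: LawlerSchrammWerner2003Restriction, Prop. 5.3] -/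
theorem martingale_Ybar {k₀ : ℕ} (hk₀ : ∀ k, k₀ ≤ k → ∀ ω, (0 : WithTop ℝ≥0) < locTime hA hne k ω) :
    Martingale (Ybar hA hne k₀) brownianFiltration preWienerMeasure := by
  haveI := isProbabilityMeasure_preWienerMeasure'
  refine Literature.Probability.Process.martingale_of_tendsto_of_abs_le (M := fun k ↦ locMart hA hne (k + k₀)) (fun k ↦ martingale_locMart)
    (C := fun _ ↦ 1) (fun k t ω ↦ ?_) (fun t ↦ ?_) (stronglyAdapted_Ybar k₀)
  · rw [abs_of_nonneg (locMart_mem_Icc t ω).1]; exact (locMart_mem_Icc t ω).2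
  · filter_upwards [ae_tendsto_locMart_Ybar hk₀] with ω hω
    exact hω t

/-- `0 ≤ Ȳ ≤ 1`. [folklore] -/
theorem Ybar_mem_Icc (k₀ : ℕ) (t : ℝ≥0) (ω : ℝ≥0 → ℝ) : Ybar hA hne k₀ t ω ∈ Icc (0 : ℝ) 1 := by
  rw [Ybar]
  have hb1 : ∀ k : ℕ, locMart hA hne (k + k₀) t ω ≤ 1 := fun k ↦ (locMart_mem_Icc t ω).2
  have hb0 : ∀ k : ℕ, 0 ≤ locMart hA hne (k + k₀) t ω := fun k ↦ (locMart_mem_Icc t ω).1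
  have hbdd : IsBoundedUnder (· ≤ ·) atTop fun k : ℕ ↦ locMart hA hne (k + k₀) t ω :=
    ⟨1, eventually_map.2 (Eventually.of_forall hb1)⟩
  have hbddb : IsBoundedUnder (· ≥ ·) atTop fun k : ℕ ↦ locMart hA hne (k + k₀) t ω :=
    ⟨0, eventually_map.2 (Eventually.of_forall hb0)⟩
  have hbdd' : IsCoboundedUnder (· ≤ ·) atTop fun k : ℕ ↦ locMart hA hne (k + k₀) t ω := hbddb.isCoboundedUnder_le
  constructor
  · exact le_limsup_of_frequently_le (Frequently.of_forall hb0) hbdd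
  · exact limsup_le_of_le hbdd' (Eventually.of_forall hb1)

end Nesting

end Literature.Probability.RandomPlanarGeometry
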